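import Summits.BirchSwinnertonDyer.Rank1Residual.Additive.RamifiedSevenGenusDirichletReading
import Literature.NumberTheory.QuadraticFields.JacobiCharacter
import Literature.NumberTheory.GaussSums.StickelbergerElement
import HarnessLib

set_option autoImplicit false

/-!
# `𝒞₇` genus road (crux `EllipticUnitValueSevenOfGZK`, K7r), the (5)-unit programme (SUMMON GENUS-UNIT-A6), File (A6-1):
# THE `χ(Xₙ)` STICKELBERGER DICTIONARY — the INTEGER exponents `y` of the twisted Sinnott unit `ξ♯ₙ = ∏_h (h ξₙ)^{y_h}`
# and their character sums `Σ_h y_h·χ(h)⁻¹ = (N𝔞 − Ψ(N𝔞)⁻¹)·((Σ_{a mod m} a·Ψ(a))/m)·ψ(b)`, so that the master identity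
# ★★★′ gives `2·S_χ(θₙ) + (Σ_h y_h·χ(h)⁻¹)·S_χ(ξₙ) = 0` (memo S7 (γ), residual (s2); THEOREMS ONLY, the exponent is SPELLED OUT)

Cell bsd-cm, seat bsd-cm-k-ty1 g27 (literature-prover); SUMMON `wake/SUMMON-bsd-cm-k-ty1-20260830T2140Z.md` (planner g36,
D972) block (A6-1); sign audit = bsd-cm STATUS «SIGN AUDIT (s2)» (this seat).  For a level `m` (the road: `mₙ = 7^{n+1}|D|`),
an integer `N` prime to `m` (the road: `N𝔞 = F.normA`) and a torsor coordinate `b ∈ (ℤ/m)ˣ` (★★★′: `Φ(ζsys n) = e^{2πi bₙ/mₙ}`):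

* §1 THE EXPONENT FUNCTION UPSTAIRS on `(ℤ/m)ˣ` (spelled out, never defined; every theorem takes `Y : (ℤ/m)ˣ → ℤ` with the
  defining equation `hY`): with `c := (b·g)⁻¹`, `c̄ ∈ [0, m)` its representative,
  `Y(g) = (c̄/7)·⌊N·c̄/m⌋ = J(c̄ | 7) * (N * c̄ / m : ℕ)`; `⌊N c̄/m⌋ = N⟨c/m⟩ − ⟨Nc/m⟩` is the `σ_c⁻¹`-coefficient of Lang's
  integral element `(N − σ_N)θ(m) ∈ ℤ[G]` (FAC 2, with the TRUE integer `N`, not `N mod m`: `natCast_mul_val_div_eq`), and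
  `(c̄/7)` is the twist by `χ_K = (·/7)`, `K = ℚ(√−7)`; so `Y` = the coefficient at `σ_g` of `σ_b⁻¹·tw_{χ_K}((N − σ_N)θ(m))`.
  DOWNSTAIRS, along any hom `T : (ℤ/m)ˣ → Gal(L/ℚ)` (C2b-γ `exists_transport`), `y(h) = ∑ᶠ g, T g = h, Y(g)`.
* §2 ★ `sum_twistExponent_mul_inv` — THE DICTIONARY UPSTAIRS: for Dirichlet characters `ψ, Ψ` mod `m` with
  `Ψ(k) = ψ(k)·(k/7)` (the road's odd partner), `Σ_g Y(g)·ψ(g)⁻¹ = ((N : ℂ) − Ψ(N)⁻¹)·((Σ_{a : ZMod m} ā·Ψ(a))/m)·ψ(b)` —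
  EXACTLY ★★★′'s bracket at level `M = m` (B3b `exists_masterIdentity_of_isNormedEllipticUnitFamily`), for EVERY `ψ`
  (no parity, no `η₁`-block hypothesis).  Road: `g ↦ c = (bg)⁻¹` (`ψ(g)⁻¹ = ψ(b)ψ(c)`), units ↦ all residues,
  `m·⌊Nā/m⌋ = Nā − \overline{Na}`, `a ↦ Na` (`Ψ(N⁻¹a) = Ψ(N)⁻¹Ψ(a)`).
* §3 `finsum_fiber_twistExponent_mul_inv` — THE DICTIONARY DOWNSTAIRS: `∑ᶠ h, y(h)·χ(h)⁻¹ =` the same, for every character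
  `χ` of a finite group read through `T` by `ψ` (`χ(T g) = ψ(g)`).
* §4 `exists_oddPartner` — for `7 ∣ m` and `ψ` even, `Ψ := ψ·(·/7)` mod `m` is a Dirichlet character mod `m` with
  `Ψ(k) = ψ(k)·(k/7)` for all `k ∈ ℕ` and `Ψ` ODD (`(−1/7) = −1`) — the `Ψ` that ★★★′ quantifies over.
* §5 ★★ `secondFactor_eq_zero_of_masterIdentity` — the corollary in C2b-β's currency: from ★★★′'s display for `(χ, ψ, Ψ, b)` and
  `(N/7) = 1`: `2 * S_χ(θ) + (∑ᶠ h, y h·(χ h)⁻¹) * S_χ(ξ) = 0` (`2·(−½) = −1`; the one hidden constant is `(N𝔞/7) = +1`,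
  discharged from the value pin in File (A6-2): `ℚ(√−7)` has class number one and Gauss's genus character is a class invariant).

HONEST LABEL: bookkeeping over `ℤ/m`; no definition, no named fact, no instance;
nothing closes; stmt-BirchSwinnertonDyer-19945 OPEN; K1ᵘ NOT proved; `X12.CMRamifiedSeven` NOT proved; no summit statement is proved
by this seat; BSD is claimed for no curve.

## References
* S. Lang, *Cyclotomic Fields I–II* (1990) Ch. 1 §2 FAC 2 (PDF p. 25, «(b − σ_b)θ(m) = Σ (b⟨c/m⟩ − ⟨bc/m⟩) σ_c⁻¹»), Ch. 1 §3
  (PDF p. 27, `B_{1,χ}`), Ch. 2 §1 (PDF p. 36, «χ(θ) = B_{1,χ̄}»), Ch. 3 §5 (PDF p. 71) [Lang1990].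
* L. C. Washington, *Introduction to Cyclotomic Fields* (1997) §6.2 (Stickelberger), §8.3, Ch. 3 (pp. 19–21) [Washington1997].
* D. A. Cox, *Primes of the form x² + ny²* (2013) §1.C Lemma 1.14 [Cox2013]; T. Tsuji, J. Number Theory 78 (1999) §6 (p. 20) [Tsuji1999].
* Tree: `GaussSums/StickelbergerElement.lean` (`frac`, FAC 2), `QuadraticFields/JacobiCharacter.lean`, B3b (p789711), C2a (p790156),
  C2b-β (p790518), C2b-γ (p790752).
-/

noncomputable section

open scoped NumberField NumberTheorySymbols
open Field Finset
open Literature.NumberTheory.QuadraticFields (jacobiChar jacobiChar_natCast jacobiChar_intCast)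
open Literature.NumberTheory.GaussSums (StickelbergerElement.frac StickelbergerElement.frac_def)

namespace Summit.BirchSwinnertonDyer.Rank1Residual.Additive.GenusSeven

/-! ## §1 The exponent function `Y = σ_b⁻¹·tw_{χ_K}((N − σ_N)θ(m))` upstairs: its coefficient arithmetic -/

/-
THE EXPONENT (spelled out in every statement below):
  `Y g = J(((((b * g)⁻¹ : (ZMod m)ˣ) : ZMod m).val : ℤ) | 7) * ((N * (((b * g)⁻¹ : (ZMod m)ˣ) : ZMod m).val / m : ℕ) : ℤ)`
= `(c̄/7)·⌊N·c̄/m⌋`, `c = (b·g)⁻¹`: the coefficient at `σ_g` of `σ_b⁻¹ · tw_{χ_K}((N − σ_N)θ(m)) ∈ ℤ[(ℤ/m)ˣ]`,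
`tw_{χ_K}(σ_c) = (c/7)σ_c`, `θ(m) = Σ ⟨c/m⟩σ_c⁻¹` (Lang's integral element, with the integer `N`) — the exponents of the
twisted Sinnott unit `ξ♯ₙ` (memo S7).  [Lang1990, Ch. 1 §2 FAC 2 (PDF p. 25); Washington1997, §6.2]
-/

/-- **`⌊N c̄/m⌋ = N⟨c/m⟩ − ⟨Nc/m⟩`** for ANY natural number `N` (Lang's FAC 2 coefficient with the integer `N`; the tree's
`frac_mul_sub_frac_eq_div` is the case `N = b̄ < m`). [cite: Lang1990, Ch. 1 §2 (PDF pp. 24–25, «b⟨t⟩ − ⟨bt⟩ ∈ ℤ», FAC 2)] -/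
theorem natCast_mul_val_div_eq {m : ℕ} [NeZero m] (N : ℕ) (c : ZMod m) :
    ((N * c.val / m : ℕ) : ℚ) = (N : ℚ) * StickelbergerElement.frac m c - StickelbergerElement.frac m ((N : ZMod m) * c) := by
  have hm : (0 : ℚ) < m := by exact_mod_cast NeZero.pos m
  have hmod : ((N : ZMod m) * c).val = N * c.val % m := by rw [ZMod.val_mul, ZMod.val_natCast, Nat.mod_mul_mod]
  rw [StickelbergerElement.frac_def, StickelbergerElement.frac_def, hmod]
  have h := Nat.div_add_mod (N * c.val) m
  have h' : ((N * c.val % m : ℕ) : ℚ) = (N : ℚ) * c.val - (m : ℚ) * ((N * c.val / m : ℕ) : ℚ) := by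
    have := congrArg (Nat.cast : ℕ → ℚ) h
    push_cast at this
    linarith
  rw [h']
  field_simp
  ring

/-- The same over `ℂ`, cleared of denominators: `m·⌊Nā/m⌋ = N·ā − \overline{N a}`. [cite: Lang1990, Ch. 1 §2 (PDF p. 24)] -/
theorem natCast_mul_natCast_mul_val_div {m : ℕ} [NeZero m] (N : ℕ) (a : ZMod m) :
    (m : ℂ) * ((N * a.val / m : ℕ) : ℂ) = (N : ℂ) * (a.val : ℂ) - ((((N : ZMod m) * a).val : ℕ) : ℂ) := by
  have hmod : ((N : ZMod m) * a).val = N * a.val % m := by rw [ZMod.val_mul, ZMod.val_natCast, Nat.mod_mul_mod]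
  rw [hmod]
  have h := Nat.div_add_mod (N * a.val) m
  have h' := congrArg (Nat.cast : ℕ → ℂ) h
  push_cast at h'
  linear_combination h'

/-! ## §2 The dictionary upstairs: `Σ_g Y(g)·ψ(g)⁻¹ = (N − Ψ(N)⁻¹)·((Σ_a ā·Ψ(a))/m)·ψ(b)` -/

section Upstairs

variable {m : ℕ} [NeZero m]

omit [NeZero m] in
/-- `ψ(g)⁻¹ = ψ(c)·ψ(b)` for `c = (b g)⁻¹` (`c·b·g = 1`). [cite: Washington1997, Ch. 3 (p. 21)] -/
theorem apply_inv_eq_mul_of_units (ψ : DirichletCharacter ℂ m) (b g : (ZMod m)ˣ) :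
    (ψ (g : ZMod m))⁻¹ = ψ ((((b * g)⁻¹ : (ZMod m)ˣ) : ZMod m)) * ψ (b : ZMod m) := by
  have h1 : ψ ((((b * g)⁻¹ : (ZMod m)ˣ) : ZMod m)) * ψ (b : ZMod m) * ψ (g : ZMod m) = 1 := by
    rw [← map_mul, ← map_mul, ← Units.val_mul, ← Units.val_mul, mul_assoc, inv_mul_cancel, Units.val_one, map_one]
  exact (eq_inv_of_mul_eq_one_left h1).symm

/-- **The odd partner reads `Y`'s Jacobi factor**: `(c̄/7)·ψ(c) = Ψ(c)` under `Ψ(k) = ψ(k)·(k/7)`.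
[cite: Cox2013, §1.C Lemma 1.14] -/
theorem jacobiSym_mul_apply_eq (ψ Ψ : DirichletCharacter ℂ m) (hΨ : ∀ k : ℕ, Ψ k = ψ k * jacobiChar 7 k)
    (c : (ZMod m)ˣ) :
    (J((((c : ZMod m)).val : ℤ) | 7) : ℂ) * ψ (c : ZMod m) = Ψ (c : ZMod m) := by
  haveI : NeZero (7 : ℕ) := ⟨by norm_num⟩
  have h := hΨ ((c : ZMod m)).val
  rw [ZMod.natCast_zmod_val, jacobiChar_natCast] at h
  rw [h, mul_comm]

/-- Sums over the units of `ℤ/m` against a Dirichlet character extend to all residues (non-units are killed).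
[cite: Washington1997, Ch. 3 (p. 21)] -/
theorem sum_units_eq_sum_zmod (Ψ : DirichletCharacter ℂ m) (f : ZMod m → ℂ) :
    ∑ c : (ZMod m)ˣ, f (c : ZMod m) * Ψ (c : ZMod m) = ∑ a : ZMod m, f a * Ψ a := by
  classical
  rw [← Finset.sum_subset (Finset.subset_univ (Finset.univ.map ⟨((↑) : (ZMod m)ˣ → ZMod m), Units.val_injective⟩))
    (fun a _ ha => by
      have hau : ¬ IsUnit a := fun hu => ha (Finset.mem_map.mpr ⟨hu.unit, Finset.mem_univ _, rfl⟩)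
      rw [MulChar.map_nonunit _ hau, mul_zero])]
  rw [Finset.sum_map]
  rfl

/-- **`Σ_{a mod m} \overline{Na}·Ψ(a) = Ψ(N)⁻¹·Σ_{a mod m} ā·Ψ(a)`** for `N` prime to `m` (reindex `a ↦ Na`).
[cite: Lang1990, Ch. 1 §2 (PDF p. 25)] -/
theorem sum_val_mul_natCast_mul_apply (Ψ : DirichletCharacter ℂ m) {N : ℕ} (hN : N.Coprime m) :
    ∑ a : ZMod m, ((((N : ZMod m) * a).val : ℕ) : ℂ) * Ψ a = (Ψ N)⁻¹ * ∑ a : ZMod m, (a.val : ℂ) * Ψ a := by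
  set u : (ZMod m)ˣ := ZMod.unitOfCoprime N hN with hu
  have huN : ((u : (ZMod m)ˣ) : ZMod m) = (N : ZMod m) := ZMod.coe_unitOfCoprime N hN
  have hΨN : Ψ N ≠ 0 := (((ZMod.isUnit_iff_coprime N m).mpr hN).map Ψ).ne_zero
  rw [Finset.mul_sum]
  -- reindex by the permutation `a ↦ N • a`
  refine Fintype.sum_equiv u.mulLeft _ _ fun a => ?_
  rw [Units.mulLeft_apply, huN, map_mul,
    show (Ψ N)⁻¹ * (((((N : ZMod m) * a).val : ℕ) : ℂ) * (Ψ N * Ψ a)) =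
      ((Ψ N)⁻¹ * Ψ N) * (((((N : ZMod m) * a).val : ℕ) : ℂ) * Ψ a) by ring,
    inv_mul_cancel₀ hΨN, one_mul]

/-- ★ **THE DICTIONARY UPSTAIRS**: for `N` prime to `m`, `b ∈ (ℤ/m)ˣ`, and Dirichlet characters `ψ, Ψ` mod `m` with
`Ψ(k) = ψ(k)·(k/7)` (`k ∈ ℕ`):
`Σ_{g ∈ (ℤ/m)ˣ} Y(g)·ψ(g)⁻¹ = ((N : ℂ) − Ψ(N)⁻¹)·((Σ_{a : ZMod m} ā·Ψ(a))/m)·ψ(b)` — the `ψ⁻¹`-value of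
`σ_b⁻¹·tw_{χ_K}((N − σ_N)θ(m))`, in ★★★′'s raw first-moment currency at the SAME level `m`; valid for EVERY `ψ`.
[cite: Lang1990, Ch. 1 §2 FAC 2 (PDF p. 25) and Ch. 2 §1 (PDF p. 36, «χ(θ) = B_{1,χ̄}»)] [cite: Washington1997, §6.2] -/
theorem sum_twistExponent_mul_inv {N : ℕ} (hN : N.Coprime m) (b : (ZMod m)ˣ) (Y : (ZMod m)ˣ → ℤ)
    (hY : ∀ g : (ZMod m)ˣ, Y g = J(((((b * g)⁻¹ : (ZMod m)ˣ) : ZMod m).val : ℤ) | 7) *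
      ((N * (((b * g)⁻¹ : (ZMod m)ˣ) : ZMod m).val / m : ℕ) : ℤ))
    (ψ Ψ : DirichletCharacter ℂ m) (hΨ : ∀ k : ℕ, Ψ k = ψ k * jacobiChar 7 k) :
    ∑ g : (ZMod m)ˣ, (Y g : ℂ) * (ψ (g : ZMod m))⁻¹ =
      ((N : ℂ) - (Ψ N)⁻¹) * ((∑ a : ZMod m, (a.val : ℂ) * Ψ a) / m) * ψ (b : ZMod m) := by
  have hm : (m : ℂ) ≠ 0 := by exact_mod_cast NeZero.ne m
  -- (1) `g ↦ c = (b g)⁻¹` and `ψ(g)⁻¹ = ψ(c)ψ(b)`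
  have h1 : ∑ g : (ZMod m)ˣ, (Y g : ℂ) * (ψ (g : ZMod m))⁻¹ =
      ψ (b : ZMod m) * ∑ c : (ZMod m)ˣ, ((N * ((c : ZMod m)).val / m : ℕ) : ℂ) * Ψ (c : ZMod m) := by
    rw [Finset.mul_sum]
    refine Fintype.sum_equiv ((Equiv.mulLeft b).trans (Equiv.inv (ZMod m)ˣ)) _ _ fun g => ?_
    simp only [Equiv.trans_apply, Equiv.coe_mulLeft, Equiv.inv_apply]
    rw [hY g, Int.cast_mul, Int.cast_natCast, apply_inv_eq_mul_of_units ψ b g,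
      ← jacobiSym_mul_apply_eq ψ Ψ hΨ (b * g)⁻¹]
    ring
  -- (2) units ↦ all residues; (3) clear the denominator; (4) `a ↦ Na`
  have h2 := sum_units_eq_sum_zmod Ψ (fun a : ZMod m => ((N * a.val / m : ℕ) : ℂ))
  have h3 : (m : ℂ) * ∑ a : ZMod m, ((N * a.val / m : ℕ) : ℂ) * Ψ a =
      (N : ℂ) * ∑ a : ZMod m, (a.val : ℂ) * Ψ a - ∑ a : ZMod m, ((((N : ZMod m) * a).val : ℕ) : ℂ) * Ψ a := by
    rw [Finset.mul_sum, Finset.mul_sum, ← Finset.sum_sub_distrib]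
    refine Finset.sum_congr rfl fun a _ => ?_
    rw [← mul_assoc, natCast_mul_natCast_mul_val_div N a]
    ring
  rw [sum_val_mul_natCast_mul_apply Ψ hN] at h3
  rw [h1, h2]
  have h4 : ∑ a : ZMod m, ((N * a.val / m : ℕ) : ℂ) * Ψ a =
      ((N : ℂ) - (Ψ N)⁻¹) * ((∑ a : ZMod m, (a.val : ℂ) * Ψ a) / m) := by
    field_simp
    linear_combination h3
  rw [h4]
  ring

end Upstairs

/-! ## §3 The dictionary downstairs along a transport `T : (ℤ/m)ˣ → Gal(L/ℚ)` -/

section Downstairs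

variable {m : ℕ} [NeZero m] {Γ : Type} [Group Γ] [Finite Γ]

omit [Group Γ] in
/-- **Fibre sums are read through `T`**: `∑ᶠ h, (∑ᶠ g, T g = h, Y g)·F(h) = Σ_g Y(g)·F(T g)`.
[cite: Washington1997, Ch. 3 (pp. 19–21)] -/
theorem finsum_fiber_mul_eq_sum (T : (ZMod m)ˣ → Γ) (Y : (ZMod m)ˣ → ℤ) (F : Γ → ℂ) :
    ∑ᶠ h : Γ, ((∑ᶠ (g : (ZMod m)ˣ) (_ : T g = h), Y g : ℤ) : ℂ) * F h = ∑ g : (ZMod m)ˣ, (Y g : ℂ) * F (T g) := by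
  classical
  haveI : Fintype Γ := Fintype.ofFinite Γ
  rw [finsum_eq_sum_of_fintype]
  have hfib : ∀ h : Γ, (∑ᶠ (g : (ZMod m)ˣ) (_ : T g = h), Y g) = ∑ g ∈ Finset.univ.filter (fun g => T g = h), Y g :=
    fun h => finsum_cond_eq_sum_of_cond_iff Y (fun {g} _ => by simp)
  simp_rw [hfib]
  push_cast
  simp_rw [Finset.sum_mul]
  rw [← Finset.sum_fiberwise Finset.univ T (fun g => (Y g : ℂ) * F (T g))]
  refine Finset.sum_congr rfl fun h _ => Finset.sum_congr rfl fun g hg => ?_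
  rw [(Finset.mem_filter.mp hg).2]

/-- **THE DICTIONARY DOWNSTAIRS**: for a hom `T : (ℤ/m)ˣ → Γ` (`Γ = Gal(L/ℚ)`), a character `χ` of `Γ` READ through `T` by the
Dirichlet character `ψ` (`χ(T g) = ψ(g)`), and `y(h) := ∑ᶠ g, T g = h, Y(g)` (`Y` the exponent of §1, by `hY`):
`∑ᶠ h, y(h)·χ(h)⁻¹ = ((N : ℂ) − Ψ(N)⁻¹)·((Σ_{a : ZMod m} ā·Ψ(a))/m)·ψ(b)`.
[cite: Lang1990, Ch. 2 §1 (PDF p. 36)] [cite: Washington1997, Ch. 3 (pp. 19–21) and §6.2] -/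
theorem finsum_fiber_twistExponent_mul_inv {N : ℕ} (hN : N.Coprime m) (b : (ZMod m)ˣ) (Y : (ZMod m)ˣ → ℤ)
    (hY : ∀ g : (ZMod m)ˣ, Y g = J(((((b * g)⁻¹ : (ZMod m)ˣ) : ZMod m).val : ℤ) | 7) *
      ((N * (((b * g)⁻¹ : (ZMod m)ˣ) : ZMod m).val / m : ℕ) : ℤ))
    (ψ Ψ : DirichletCharacter ℂ m) (hΨ : ∀ k : ℕ, Ψ k = ψ k * jacobiChar 7 k) (T : (ZMod m)ˣ →* Γ) (χ : Γ →* ℂˣ)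
    (hχT : ∀ g : (ZMod m)ˣ, ((χ (T g) : ℂˣ) : ℂ) = ψ (g : ZMod m)) :
    ∑ᶠ h : Γ, ((∑ᶠ (g : (ZMod m)ˣ) (_ : T g = h), Y g : ℤ) : ℂ) * ((χ h : ℂˣ) : ℂ)⁻¹ =
      ((N : ℂ) - (Ψ N)⁻¹) * ((∑ a : ZMod m, (a.val : ℂ) * Ψ a) / m) * ψ (b : ZMod m) := by
  rw [finsum_fiber_mul_eq_sum T Y (fun h => ((χ h : ℂˣ) : ℂ)⁻¹)]
  simp_rw [hχT]
  exact sum_twistExponent_mul_inv hN b Y hY ψ Ψ hΨ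

end Downstairs

/-! ## §4 The odd partner `Ψ = ψ·(·/7)` mod `m` -/

section OddPartner

variable {m : ℕ} [NeZero m]

/-- **The odd partner exists at the same level**: for `7 ∣ m` and `ψ` mod `m` EVEN, `Ψ := ψ·(·/7)` (lifted to level `m`) is a
Dirichlet character mod `m` with `Ψ(k) = ψ(k)·(k/7)` for every `k ∈ ℕ`, and `Ψ` is ODD (`(−1/7) = −1`).
[cite: Cox2013, §1.C Lemma 1.14] [cite: Washington1997, Ch. 3 (p. 21)] -/
theorem exists_oddPartner (h7 : 7 ∣ m) (ψ : DirichletCharacter ℂ m) (hψ : ψ.Even) :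
    ∃ Ψ : DirichletCharacter ℂ m, (∀ k : ℕ, Ψ k = ψ k * jacobiChar 7 k) ∧ Ψ.Odd := by
  haveI : NeZero (7 : ℕ) := ⟨by norm_num⟩
  refine ⟨ψ * DirichletCharacter.changeLevel h7 (jacobiChar 7), fun k => ?_, ?_⟩
  · rw [MulChar.mul_apply]
    by_cases hk : IsUnit (k : ZMod m)
    · obtain ⟨u, hu⟩ := hk
      rw [← hu, DirichletCharacter.changeLevel_eq_cast_of_dvd _ h7 u, hu, ZMod.cast_natCast h7]
    · rw [MulChar.map_nonunit ψ hk, zero_mul, zero_mul]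
  · rw [DirichletCharacter.Odd, MulChar.mul_apply, hψ, one_mul]
    have h1 : ((-1 : ℤ) : ZMod m) = -1 := by push_cast; rfl
    rw [← h1, DirichletCharacter.changeLevel_eq_cast_of_dvd' _ h7 (Int.isCoprime_iff_gcd_eq_one.mpr (by simp)),
      jacobiChar_intCast, jacobiSym.at_neg_one (by decide), ZMod.χ₄_nat_three_mod_four (by norm_num)]
    push_cast
    rfl

end OddPartner

/-! ## §5 The corollary: the second factor of C2b-β's `hvan` vanishes -/

section SecondFactor

variable {m : ℕ} [NeZero m] {Γ : Type} [Group Γ] [Finite Γ]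

omit [NeZero m] in
/-- `(N/7) = 1 ⇒ Ψ(N) = ψ(N)` under `Ψ(k) = ψ(k)·(k/7)`. [cite: Cox2013, §1.C Lemma 1.14] -/
theorem oddPartner_apply_eq_of_jacobiChar_eq_one {N : ℕ} (ψ Ψ : DirichletCharacter ℂ m)
    (hΨ : ∀ k : ℕ, Ψ k = ψ k * jacobiChar 7 k) (hK : jacobiChar 7 N = 1) : Ψ N = ψ N := by
  rw [hΨ N, hK, mul_one]

/-- ★★ **THE SECOND FACTOR VANISHES**: in C2b-β's currency, for a character `χ` of `Γ = Gal(L/ℚ)` read through `T` by `ψ`, the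
exponents `y(h) = ∑ᶠ g, T g = h, Y(g)` (`hY`), an odd partner `Ψ`, `(N/7) = 1`, and ★★★′'s master identity
`S_χ(θ) = −½·(N − ψ(N)⁻¹)·((Σ_a ā·Ψ(a))/m)·ψ(b)·S_χ(ξ)` (any complex numbers `Sθ`, `Sξ` — in the road the χ-logarithms of
`θu n` and `ξu n`): `2·S_χ(θ) + (∑ᶠ h, y(h)·χ(h)⁻¹)·S_χ(ξ) = 0` (`2·(−½) = −1`).
[cite: Kato2004Asterisque, §15.5 (15.5.1) (p. 253)] [cite: Lang1990, Ch. 2 §1 (PDF p. 36) and Ch. 3 §5 (PDF p. 71)] -/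
theorem secondFactor_eq_zero_of_masterIdentity {N : ℕ} (hN : N.Coprime m) (b : (ZMod m)ˣ) (Y : (ZMod m)ˣ → ℤ)
    (hY : ∀ g : (ZMod m)ˣ, Y g = J(((((b * g)⁻¹ : (ZMod m)ˣ) : ZMod m).val : ℤ) | 7) *
      ((N * (((b * g)⁻¹ : (ZMod m)ˣ) : ZMod m).val / m : ℕ) : ℤ))
    (ψ Ψ : DirichletCharacter ℂ m) (hΨ : ∀ k : ℕ, Ψ k = ψ k * jacobiChar 7 k) (hK : jacobiChar 7 N = 1)
    (T : (ZMod m)ˣ →* Γ) (χ : Γ →* ℂˣ) (hχT : ∀ g : (ZMod m)ˣ, ((χ (T g) : ℂˣ) : ℂ) = ψ (g : ZMod m)) {Sθ Sξ : ℂ}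
    (hmaster : Sθ = -(1 / 2) * ((N : ℂ) - (ψ N)⁻¹) * ((∑ a : ZMod m, (a.val : ℂ) * Ψ a) / m) * ψ (b : ZMod m) * Sξ) :
    2 * Sθ + (∑ᶠ h : Γ, ((∑ᶠ (g : (ZMod m)ˣ) (_ : T g = h), Y g : ℤ) : ℂ) * ((χ h : ℂˣ) : ℂ)⁻¹) * Sξ = 0 := by
  rw [finsum_fiber_twistExponent_mul_inv hN b Y hY ψ Ψ hΨ T χ hχT, oddPartner_apply_eq_of_jacobiChar_eq_one ψ Ψ hΨ hK,
    hmaster]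
  ring

end SecondFactor

end Summit.BirchSwinnertonDyer.Rank1Residual.Additive.GenusSeven

end
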